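import Mathlib.Tactic.Linarith
import Mathlib.Tactic.NormNum
import Mathlib.Tactic.Ring
import HarnessLib

/-!
# The (0,1) cell of the ι-window, XXX-B: the product ground `B₁ × B₂`, XVII (ADDENDUM 1) — THE CORNER's base design in every shape
# (report [XXX] `H2-ZERO-ONE-30.md` §13): arithmetic shadows

Family `hodge`, b2b cell `hweil` (helper of item stmt-HodgeConjecture-2524). Companion (`pg17a_*`) of `WeilTypeLadderH2ProductGroundSeventeen.lean`
(same seat). Report `run/shared/lean/b2b/hodge-weil/b2b-hweil-pv1-g42/H2-ZERO-ONE-30.md` ([XXX]) §13 (ADDENDUM 1: PROPOSITION BASE — the base four-piece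
design `{𝒪_V(2θ₁−θ₂), 𝒪_H(2θ₁), 𝒪_V(θ₂), 𝒪_H(2θ₂)}` of the corner `(2Θ_{κ₁}, 2Θ_{κ₂})` is POPULATED in every shape and VOID). HONEST FRAMING: census
results inside the ladder's H2 test ((0,1) cell) on the SPECIAL fourfold `X₀ = B₁ × B₂`; nothing here is a rung; no case of the Hodge conjecture is
proved; no statement of [Markman 2025] / [Perry 2026] / [EdGFS 2025] is used. Every theorem is a def-free arithmetic statement that the report cites at
the step named in its docstring; none claims geometry.
-/

-- mandated namespace `Summit.HodgeConjecture.HodgeConjecture.…` (Problem = Summit) trips `linter.dupNamespace`; the lakefile disables it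
-- tree-wide (weak option), restated here so stand-alone elaboration is warning-free too.
set_option linter.dupNamespace false

namespace Summit.HodgeConjecture.HodgeConjecture.WeilTypeLadder

section ProductGroundSeventeenAdd1

/-- **[XXX] 13.2 / PROPOSITION BASE (a): the eigenspaces of the two 20-dimensional extension groups.** `Ext¹(a, c) = H¹(C₁, K^{−2}) ⊗ H⁰(B₂, 𝒪(2Θ₀))`
with the reference linearisations (canonical on `K^{−2}`: split `(anti, inv) = (4, 1)` by holomorphic Lefschetz on the genus-2 curve; totally symmetric on
`𝒪(2Θ₀)`: all four sections EVEN — Lefschetz on the abelian surface: `h⁰₊ − h⁰₋ = Σ_{16 half-periods} e_*(x)/4 = 16/4 = 4 = h⁰`), so the product splits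
`(anti, inv) = (4·4, 1·4) = (16, 4)`, `16 + 4 = 20`; the V-sheaf `T` with pieces `c ⊂ T ↠ a` is balanced iff its class is ANTI-invariant (`t(a) = t(c)`, factor
`1 + s`), a `16`-dimensional space; likewise `Ext¹(d, b)`. [`norm_num`] -/
theorem pg17a_twenty_split :
    (4:ℤ) * 4 = 16 ∧ (1:ℤ) * 4 = 4 ∧ (16:ℤ) + 4 = 20 ∧ (5:ℤ) * 4 = 20 ∧
    (∀ hp hm : ℤ, hp + hm = 4 → hp - hm = 16 / 4 → hp = 4 ∧ hm = 0) ∧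
    (∀ s : ℤ, (s = 1 ∨ s = -1) → ((2:ℤ) * (1 + s) = 0 ↔ s = -1)) := by
  refine ⟨by norm_num, by norm_num, by norm_num, by norm_num, fun hp hm h1 h2 => by omega, fun s hs => ?_⟩
  rcases hs with rfl | rfl <;> simp

/-- **[XXX] 13.3 / PROPOSITION BASE (b)–(c): the Yoneda obstruction and the split loci.** `Ext²(d, a) = H⁰(C₁, 2K₁) ⊗ H¹(C₂, K^{−2})` has dimension
`3·5 = 15`; the cup product with the class of `𝒪_R(2θ₁)` is `(restriction H⁰(B₁, 2Θ₀) → H⁰(C₁, 2K₁)) ⊗ δ` with `δ` injective (`0 → Ext¹(i_*2K, i_*𝒪_C) → Ext²(i_*2K, 𝒪(−Θ))`,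
`5 → 5`, the preceding term `Ext¹_{B₂}(i_*2K₂, 𝒪) = H⁰(C₂, K^{−1}) = 0`), so its kernel is `ker(restriction) ⊗ H¹ = ℂ·s_{κ₁}² ⊗ H¹(C₂, K^{−2})`, of dimension
`(4 − 3)·5 = 5` — PROPOSITION C-EXT's locus: with `T` split, `F` is simple iff `Q`'s class lies there. The locally free members with BOTH halves non-split
need split restrictions to `S` on both sides: classes in `H¹(C₁, K^{−2}) ⊗ ℂ·s_{κ₂}²` and `ℂ·s_{κ₁}² ⊗ H¹(C₂, K^{−2})` (`5` and `5`; balanced parts `4` and `4`).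
[`norm_num`] -/
theorem pg17a_yoneda_counts :
    (3:ℤ) * 5 = 15 ∧ ((4:ℤ) - 3) * 5 = 5 ∧ (4:ℤ) * 5 = 20 ∧ (0:ℤ) + 5 = 5 ∧
    (∀ k r : ℤ, k + r = 20 → r ≤ 15 → 5 ≤ k) ∧ ((5:ℤ) - 1 = 4) := by
  refine ⟨by norm_num, by norm_num, by norm_num, by norm_num, fun k r h1 h2 => by omega, by norm_num⟩

/-- **[XXX] 13.4 / PROPOSITION BASE (d): the dimensions of the balanced simple families carried by the base design, all `≥ 2` (VOID by the counting
principle).** Shape (i) `T` split (= C-EXT): `ℙ(4) → 4 − 1 = 3`; shape (ii) `Q` split (the twin): `3`; shape (iii-lf) both halves non-split, locally free on `R`: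
`[e₁] ∈ ℙ³`, `[e₂] ∈ ℙ³` and the gluing ratio `[ε₁ : ε₂] ∈ ℂ^*`: `3 + 3 + 1 = 7`; shape (iii-deg) both non-split with the unique degenerate gluing: `[τ] ∈ ℙ¹⁵`,
`[q] ∈ ℙ¹⁵`: `15 + 15 = 30`; the rank-one gluings inside the split-restriction loci: `3 + 3 = 6`. Every one of `3, 7, 30, 6` is `≥ 2`; the fully split datum
(`T = a ⊕ c`, `Q = b ⊕ d`) glues to `𝒪_R(2θ₁) ⊕ 𝒪_R(2θ₂)` — decomposable (`1 + 1 = 2` summands), not simple. [`norm_num`] -/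
theorem pg17a_family_dimensions :
    ((4:ℤ) - 1 = 3) ∧ ((3:ℤ) + 3 + 1 = 7) ∧ ((16:ℤ) - 1 + (16 - 1) = 30) ∧ ((3:ℤ) + 3 = 6) ∧
    ((2:ℤ) ≤ 3 ∧ (2:ℤ) ≤ 7 ∧ (2:ℤ) ≤ 30 ∧ (2:ℤ) ≤ 6) ∧ ((1:ℤ) + 1 = 2) := by
  norm_num

/-- **[XXX] 13.7 COMPLEMENT / LEMMA NOBOX (no half of a rank-2 bundle on `R` with the H2 class is a box `E₀ ⊠ N`).** If `𝓔_V ≅ pr₁^*E₀ ⊗ pr₂^*N`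
(`E₀` of rank 2 and degree `e₀` on `C₁`, `N ≡ nθ₂`) then `c₁ = e₀f + 2nθ₂ = 4f + 2θ₂` forces `e₀ = 4`, `n = 1`, and `c₂ = c₁(pr₁^*E₀)c₁(N) + c₁(N)² = 4fθ₂ + 2ϖ`,
i.e. `(μ, m) = (4, 2)`; but PROPOSITION LEVEL requires `m = 8 − μ = 4`. Contradiction (`2 ≠ 4`): in particular 'level `k_mov = 0` with all `C₁`-fibres isomorphic
to one simple bundle and no jumping' is EMPTY, on either side. [`omega` / `norm_num`] -/
theorem pg17a_nobox :
    (∀ e₀ n : ℤ, e₀ = 4 ∧ 2 * n = 2 → e₀ = 4 ∧ n = 1) ∧ ((4:ℤ) * 1 = 4 ∧ (1:ℤ)^2 * 2 = 2) ∧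
    (∀ μ m : ℤ, m = 8 - μ → μ = 4 → m ≠ 2) := by
  refine ⟨fun e₀ n h => by omega, by norm_num, fun μ m h1 h2 => by omega⟩

/-- **[XXX] 13.5 (iv) / an independent check of C-EXT's eigenspaces by the equivariant trace identity.** HRR gives `χ(B, A) = ∫ ch(B)^∨ ch(A) = 14`
(script `corner_classes.py`), so with `Hom = Ext⁴ = 0` and `ext¹(B,A) = ext³(B,A) = 5` (Serre duality with `Ext¹(A,B)`) one has `ext²(B,A) = 14 + 5 + 5 = 24`.
T-ι's trace identity `Σ_i (−1)^i (e_i⁺ − e_i⁻) = ⟨t(B), t(A)⟩/16 = 120·2·2/16 = 30` is satisfied by the splits `(e₁⁺, e₁⁻) = (1, 4)`, `(e₃⁺, e₃⁻) = (1, 4)`: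
`−(1 − 4) + (e₂⁺ − e₂⁻) − (1 − 4) = 30` forces `e₂⁺ − e₂⁻ = 24 = e₂⁺ + e₂⁻`, i.e. `(24, 0)` — admissible; whereas `(4, 1)` on both odd groups would need
`e₂⁺ − e₂⁻ = 36 > 24` — inadmissible. [`omega` / `norm_num`] -/
theorem pg17a_lefschetz_check :
    ((14:ℤ) + 5 + 5 = 24) ∧ ((120:ℤ) * 2 * 2 / 16 = 30) ∧
    (∀ p m : ℤ, -(1 - 4) + (p - m) - (1 - 4) = 30 → p + m = 24 → p = 24 ∧ m = 0) ∧
    (∀ p m : ℤ, 0 ≤ p → 0 ≤ m → p + m = 24 → -(4 - 1) + (p - m) - (4 - 1) ≠ 30) := by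
  refine ⟨by norm_num, by norm_num, fun p m h1 h2 => by omega, fun p m hp hm h => by omega⟩

end ProductGroundSeventeenAdd1

end Summit.HodgeConjecture.HodgeConjecture.WeilTypeLadder
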